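import Summits.HodgeConjecture.HodgeConjecture.Theses.SecondaryPeriods

/-!
# Route `SecondaryPeriods`: the assembly item (read-back; retired rev-≤6 proof)

History.  This module first proved the rev-≤6 assembly item stmt-HodgeConjecture-3543,
`HodgeImpliesConiveauOne → ConiveauOneFailure → ¬ HodgeConjecture`, by modus tollens
(`assembly_proof`, 2026-08-16).  Route-repair rev 7 (2026-08-16T18:35Z) RESTATED the route decl
`Assembly` to stmt-HodgeConjecture-16342, `ConiveauOneFailure → ¬ HodgeConjecture`: Grothendieck's
observation HC ⟹ GHC(3,1) is no longer a hypothesis but is PROVED inside the route's deciding theorem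
`Theses.SecondaryPeriods.closes (hRiemann : RiemannWeightOne) (hFail : ConiveauOneFailure) :
¬ HodgeConjecture` — modulo the route's crux #6 `RiemannWeightOne` (Riemann's existence theorem for
polarisable weight-one Hodge structures in geometric form, stmt-HodgeConjecture-16406, open).  So the
restated `Assembly` is provable today exactly modulo `RiemannWeightOne` and has no sorry-free proof;
this module now only records its read-back (`assembly_iff`), and the old modus-tollens proof, which no
longer matches the decl, survives in name only, as a deprecated alias of that read-back (Theorems files
are append-only).  Once `RiemannWeightOne` is proved (say by `h`), `Theses.SecondaryPeriods.closes h :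
Assembly` closes stmt-HodgeConjecture-16342.
-/

-- `Summit.HodgeConjecture.HodgeConjecture.Theorems` is the mandated namespace (single-conjunct summit:
-- Sub = Summit), which `linter.dupNamespace` flags on every declaration; the lakefile turns the
-- linter off tree-wide (weak option), restated here so stand-alone elaboration is warning-free too.
set_option linter.dupNamespace false

namespace Summit.HodgeConjecture.HodgeConjecture.Theorems

/-- **Read-back of the restated assembly item** (stmt-HodgeConjecture-16342, route rev 7):
`Assembly` is literally `ConiveauOneFailure → ¬ HodgeConjecture` — the failure of the generalised
Hodge conjecture in level one for threefolds refutes the Hodge conjecture.  Definitional; recorded so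
that this module states what its retired proof below no longer proves.  The implication itself is the
route's deciding theorem `Theses.SecondaryPeriods.closes` MODULO the open crux `RiemannWeightOne`
(Grothendieck 1969, p. 301: HC for the fourfolds `Y × C` ⟹ GHC(3,1) for `Y`, via Riemann's existence
theorem for polarisable weight-one Hodge structures; then modus tollens).
[cite: GrothendieckTopology1969, p. 301] [cite: Deligne2000, §1] -/
theorem assembly_iff :
    Theses.SecondaryPeriods.Assembly ↔
      (Theses.SecondaryPeriods.ConiveauOneFailure → ¬ _root_.HodgeConjecture) :=
  Iff.rfl

/-- Former proof of the rev-≤6 assembly item stmt-HodgeConjecture-3543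
(`HodgeImpliesConiveauOne → ConiveauOneFailure → ¬ HodgeConjecture`, modus tollens; superseded at
route rev 7, whose `Assembly` drops the first hypothesis and is NOT provable sorry-free until the crux
`RiemannWeightOne` is discharged — the implication is the route's deciding theorem
`Theses.SecondaryPeriods.closes : RiemannWeightOne → ConiveauOneFailure → ¬ HodgeConjecture`).  The
name is kept (Theorems files are append-only) as a deprecated alias of the read-back `assembly_iff`;
it proves nothing about `Assembly` any more.  Once `RiemannWeightOne` is proved by some `h`,
`Theses.SecondaryPeriods.closes h : Assembly` closes stmt-HodgeConjecture-16342 (under a new name).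
[cite: GrothendieckTopology1969, p. 301] -/
@[deprecated assembly_iff (since := "2026-08-17")]
alias assembly_proof := assembly_iff

end Summit.HodgeConjecture.HodgeConjecture.Theorems
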